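import Mathlib.CategoryTheory.Adjunction.Limits
import Mathlib.CategoryTheory.Limits.Preserves.Finite
import Mathlib.CategoryTheory.Limits.Preserves.Shapes.BinaryProducts
import Mathlib.Logic.Equiv.Option
import Literature.AnabelianGeometry.SemiGraphs.QuasiTemperoidsRemarksProofs
import Literature.AnabelianGeometry.SemiGraphs.TemperoidsProductLayer
import HarnessLib

/-!
# Semi-graphs of anabelioids, Appendix: quasi-temperoids — Proposition A.2 (i) (proof)

Mochizuki, *Semi-graphs of anabelioids*, Publ. RIMS **42** (2006), Appendix, Proposition A.2 (i),
manuscript p. 80 [cite: MochizukiSemiAnbd2006, Prop A.2(i) p.80]: for a countable family of connected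
quasi-temperoids `Q_e` and `Q = ∏_e Q_e`, "the natural projection functor `π_e^* : Q → Q_e` determines a
morphism of quasi-temperoids `Q_e → Q`" (printed proof, p. 81: "follows immediately from the
definitions").  PROOF-ONLY companion of `QuasiTemperoids.lean` (abc-iut-L3-t2): no definitions; the
named fact `PropA2i` is DISCHARGED (`PropA2i_holds`).

Contents.
* The product-category layer, for an index type in ANY universe (Mathlib's
  `CategoryTheory.Limits.Pi` only assembles coordinatewise (co)limit cones and pins the index type to
  the morphism universe): the evaluation functor `Pi.eval C i : (∀ i, C i) ⥤ C i` preserves ALL limits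
  and ALL colimits, unconditionally (`TemperoidProduct.preservesLimitsOfShape_eval`,
  `TemperoidProduct.preservesColimitsOfShape_eval`; hence `preservesFiniteLimits_eval`).  Argument: for
  an `Option`-indexed family and `i = none`, a cone over `F ⋙ Pi.eval C none` extends to a cone over
  `F` by the coordinates of the given limit cone off `none` (no transport needed); the general case is
  reindexing along `Equiv.optionSubtypeNe i` (`Pi.equivalenceOfEquiv`), under which `Pi.eval C i` is
  LITERALLY `inverse ⋙ Pi.eval _ none`.
* A connected object of `∏ Q_f` with one connected coordinate (`TemperoidProduct.isConnectedObj_of_apply'`,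
  the variant of abc-iut-L3-t10's `isConnectedObj_of_apply` WITHOUT the binary-coproduct hypothesis, now
  that evaluation is known to preserve colimits).
* `isNondegenerateObj_eval`: `π_e^*` preserves nondegenerate objects (test a connected `B` of `Q_e`
  against the connected object of `Q` that is `B` at `e` and initial elsewhere; a connected object of `Q`
  dominating it is concentrated at `e` by strictness of initial objects, `QuasiTemperoidsRemarksProofs`).
* `PropA2i_holds`.

Nothing here is specific to the abc programme; nothing takes a side on [IUTchIII] Cor. 3.12.
-/

open CategoryTheory CategoryTheory.Limits

namespace Literature.AnabelianGeometry.SemiGraphs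

open Literature.AlgebraicGeometry.Frobenioids (IsConnectedObj IsNonemptyObj)
open Literature.AlgebraicGeometry.Frobenioids.QuasiTemperoid (IsConnectedQuasiTemperoid)

universe w w₁ w₁' v₁ u u₁

namespace TemperoidProduct

/-! ### Evaluation at `none` of an `Option`-indexed product preserves (co)limits -/

section EvalNone

variable {J₀ : Type w} {C : Option J₀ → Type u₁} [∀ o, Category.{v₁} (C o)]
variable {J : Type w₁} [Category.{w₁'} J]

/-- For an `Option`-indexed family of categories, `Pi.eval C none` preserves every limit: a cone over
`F ⋙ Pi.eval C none` extends to a cone over `F` whose coordinates off `none` are those of a given limit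
cone of `F` (the exactness half of Prop. A.2 (i), at `none`). [cite: MochizukiSemiAnbd2006, Prop A.2(i) p.80] -/
theorem preservesLimit_eval_none (F : J ⥤ ∀ o, C o) : PreservesLimit F (Pi.eval C none) := by
  refine ⟨fun {c} hc => ⟨?_⟩⟩
  -- the extension of a cone `s` over `F ⋙ Pi.eval C none` by `c` off `none`
  let ext : Cone (F ⋙ Pi.eval C none) → Cone F := fun s =>
    { pt := fun o => match o with
        | none => s.pt
        | some j₀ => c.pt (some j₀)
      π :=
        { app := fun j o => match o with
            | none => s.π.app j
            | some j₀ => c.π.app j (some j₀)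
          naturality := fun j j' f => by
            funext o
            cases o with
            | none =>
              have h := s.π.naturality f
              simp only [Functor.const_obj_map, Functor.comp_map, Pi.eval_map] at h
              simp only [Functor.const_obj_map, Pi.comp_apply, Pi.id_apply]
              exact h
            | some j₀ =>
              have h := congr_fun (c.π.naturality f) (some j₀)
              simp only [Functor.const_obj_map, Pi.comp_apply, Pi.id_apply] at h ⊢
              exact h } }
  exact
    { lift := fun s => hc.lift (ext s) none
      fac := fun s j => congr_fun (hc.fac (ext s) j) none
      uniq := fun s m w => by
        let m' : (ext s).pt ⟶ c.pt := fun o => match o with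
          | none => m
          | some j₀ => 𝟙 (c.pt (some j₀))
        have hm' : m' = hc.lift (ext s) :=
          hc.uniq (ext s) m' fun j => by
            funext o
            cases o with
            | none => exact w j
            | some j₀ => exact Category.id_comp _
        exact congr_fun hm' none }

/-- For an `Option`-indexed family of categories, `Pi.eval C none` preserves every colimit (dual
construction; Prop. A.2 (i), countable colimits, at `none`). [cite: MochizukiSemiAnbd2006, Prop A.2(i) p.80] -/
theorem preservesColimit_eval_none (F : J ⥤ ∀ o, C o) : PreservesColimit F (Pi.eval C none) := by
  refine ⟨fun {c} hc => ⟨?_⟩⟩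
  let ext : Cocone (F ⋙ Pi.eval C none) → Cocone F := fun s =>
    { pt := fun o => match o with
        | none => s.pt
        | some j₀ => c.pt (some j₀)
      ι :=
        { app := fun j o => match o with
            | none => s.ι.app j
            | some j₀ => c.ι.app j (some j₀)
          naturality := fun j j' f => by
            funext o
            cases o with
            | none =>
              have h := s.ι.naturality f
              simp only [Functor.const_obj_map, Functor.comp_map, Pi.eval_map] at h
              simp only [Functor.const_obj_map, Pi.comp_apply, Pi.id_apply]
              exact h
            | some j₀ =>
              have h := congr_fun (c.ι.naturality f) (some j₀)
              simp only [Functor.const_obj_map, Pi.comp_apply, Pi.id_apply] at h ⊢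
              exact h } }
  exact
    { desc := fun s => hc.desc (ext s) none
      fac := fun s j => congr_fun (hc.fac (ext s) j) none
      uniq := fun s m w => by
        let m' : c.pt ⟶ (ext s).pt := fun o => match o with
          | none => m
          | some j₀ => 𝟙 (c.pt (some j₀))
        have hm' : m' = hc.desc (ext s) :=
          hc.uniq (ext s) m' fun j => by
            funext o
            cases o with
            | none => exact w j
            | some j₀ => exact Category.comp_id _
        exact congr_fun hm' none }

/-- `Pi.eval C none` preserves limits of every shape (Prop. A.2 (i), exactness). [cite: MochizukiSemiAnbd2006, Prop A.2(i) p.80] -/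
theorem preservesLimitsOfShape_eval_none : PreservesLimitsOfShape J (Pi.eval C none) :=
  ⟨fun {F} => preservesLimit_eval_none F⟩

/-- `Pi.eval C none` preserves colimits of every shape (Prop. A.2 (i), colimits). [cite: MochizukiSemiAnbd2006, Prop A.2(i) p.80] -/
theorem preservesColimitsOfShape_eval_none : PreservesColimitsOfShape J (Pi.eval C none) :=
  ⟨fun {F} => preservesColimit_eval_none F⟩

end EvalNone

/-! ### Evaluation at any index preserves (co)limits (reindex along `Equiv.optionSubtypeNe`) -/

section Eval

variable {I : Type w} {C : I → Type u₁} [∀ i, Category.{v₁} (C i)]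
variable {J : Type w₁} [Category.{w₁'} J]

/-- Reindexing along `Option {b // b ≠ i} ≃ I`: the evaluation at `i` IS the composite of the inverse
reindexing equivalence with the evaluation at `none` (a definitional equality). [folklore] -/
private theorem eval_eq_inverse_comp_eval_none [DecidableEq I] (i : I) :
    Pi.eval C i = (Pi.equivalenceOfEquiv C (Equiv.optionSubtypeNe i)).inverse ⋙
      Pi.eval (fun o => C (Equiv.optionSubtypeNe i o)) none :=
  rfl

/-- **The evaluation functor `Pi.eval C i : (∀ i, C i) ⥤ C i` preserves limits of every shape**, for
an index type and shape in arbitrary universes and with no existence hypothesis on limits in the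
factors — the finite-limit half of "`π_e^*` determines a morphism of quasi-temperoids" in full generality. [cite: MochizukiSemiAnbd2006, Prop A.2(i) p.80] -/
theorem preservesLimitsOfShape_eval (i : I) : PreservesLimitsOfShape J (Pi.eval C i) := by
  classical
  let E := Pi.equivalenceOfEquiv C (Equiv.optionSubtypeNe i)
  have h := preservesLimitsOfShape_eval_none (C := fun o => C (Equiv.optionSubtypeNe i o)) (J := J)
  -- `Pi.eval C i = E.inverse ⋙ Pi.eval _ none` definitionally (`eval_eq_inverse_comp_eval_none`)
  exact ⟨fun {K} => ⟨fun {c} hc =>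
    (h.preservesLimit (K := K ⋙ E.inverse)).preserves (isLimitOfPreserves E.inverse hc)⟩⟩

/-- **The evaluation functor `Pi.eval C i` preserves colimits of every shape** (the countable-colimit
half of Prop. A.2 (i), in full generality). [cite: MochizukiSemiAnbd2006, Prop A.2(i) p.80] -/
theorem preservesColimitsOfShape_eval (i : I) : PreservesColimitsOfShape J (Pi.eval C i) := by
  classical
  let E := Pi.equivalenceOfEquiv C (Equiv.optionSubtypeNe i)
  have h := preservesColimitsOfShape_eval_none (C := fun o => C (Equiv.optionSubtypeNe i o)) (J := J)
  exact ⟨fun {K} => ⟨fun {c} hc =>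
    (h.preservesColimit (K := K ⋙ E.inverse)).preserves (isColimitOfPreserves E.inverse hc)⟩⟩

/-- `Pi.eval C i` preserves finite limits (Prop. A.2 (i): `π_e^*` is left exact). [cite: MochizukiSemiAnbd2006, Prop A.2(i) p.80] -/
theorem preservesFiniteLimits_eval (i : I) : PreservesFiniteLimits (Pi.eval C i) :=
  ⟨fun _ _ _ => preservesLimitsOfShape_eval i⟩

/-- An object of `∏ᵢ Cᵢ` with one connected coordinate and all other coordinates initial is connected
(factors with strict initial objects; NO coproduct hypothesis — a colimit binary cofan of `∏ᵢ Cᵢ`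
evaluates to a colimit binary cofan of `C_{i₀}`). [cite: MochizukiSemiAnbd2006, Rmk 3.1.5 p.34] -/
theorem isConnectedObj_of_apply' [∀ i, HasInitial (C i)]
    (hstrict : ∀ i {A B : C i} (_ : A ⟶ B), IsNonemptyObj A → IsNonemptyObj B)
    {B : ∀ i, C i} (i₀ : I) (h₀ : IsConnectedObj (B i₀))
    (hrest : ∀ j, j ≠ i₀ → ¬ IsNonemptyObj (B j)) : IsConnectedObj B := by
  refine ⟨isNonemptyObj_of_apply i₀ h₀.1, fun B₁ B₂ ι₁ ι₂ hB₁ hB₂ => ⟨fun hc => ?_⟩⟩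
  have key : ∀ {B' : ∀ i, C i} (_ : B' ⟶ B), IsNonemptyObj B' → IsNonemptyObj (B' i₀) :=
    fun {B'} ι' hB' => by
      obtain ⟨j, hj⟩ := exists_isNonemptyObj_apply hB'
      by_cases hji : j = i₀
      · exact hji ▸ hj
      · exact absurd (hstrict j (ι' j) hj) (hrest j hji)
  haveI := preservesColimitsOfShape_eval (C := C) (J := Discrete WalkingPair) i₀
  exact (h₀.2 _ _ (ι₁ i₀) (ι₂ i₀) (key ι₁ hB₁) (key ι₂ hB₂)).false
    (isColimitMapCoconeBinaryCofanEquiv (Pi.eval C i₀) ι₁ ι₂ (isColimitOfPreserves (Pi.eval C i₀) hc))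

end Eval

end TemperoidProduct

/-! ### Connected quasi-temperoids: initial objects (from the chart) -/

section ConnectedQuasiTemperoid

variable {Q : Type u₁} [Category.{v₁} Q]

/-- A connected quasi-temperoid has an initial object (the empty `Π`-set over `A` in a chart
`Q ≌ B^temp(Π)[A]`). [cite: MochizukiSemiAnbd2006, Def A.1(i) p.79] -/
private theorem hasInitial_of_isConnectedQuasiTemperoid
    (hQ : IsConnectedQuasiTemperoid.{v₁, u₁, u} Q) : HasInitial Q := by
  obtain ⟨c⟩ := isConnectedQuasiTemperoid_iff_nonempty_chart.mp hQ
  obtain ⟨X, hX⟩ := overPrime_exists_isEmpty c.A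
  obtain ⟨hI⟩ := overPrime_isInitial_of_isEmpty X hX
  haveI := hI.hasInitial
  exact Adjunction.hasColimitsOfShape_of_equivalence c.equiv.functor

/-- In a connected quasi-temperoid an arrow out of a non-initial object has non-initial target
(strict initial objects, `IsConnectedQuasiTemperoid.nonempty_isInitial_of_hom`).
[cite: MochizukiSemiAnbd2006, Def A.1(i) p.79] -/
private theorem isNonemptyObj_of_hom' (hQ : IsConnectedQuasiTemperoid.{v₁, u₁, u} Q) {A B : Q}
    (f : A ⟶ B) (hA : IsNonemptyObj A) : IsNonemptyObj B := by
  by_contra hB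
  obtain ⟨hBI⟩ := TemperoidProduct.nonempty_isInitial_of_not_isNonemptyObj hB
  obtain ⟨hAI⟩ := hQ.nonempty_isInitial_of_hom hBI f
  exact hA.false hAI

end ConnectedQuasiTemperoid

/-! ### Proposition A.2 (i) -/

/-- **`π_e^*` preserves nondegenerate objects** (the content of Prop. A.2 (i) beyond exactness): if
`A ∈ ∏_f Q_f` is nondegenerate then so is its coordinate `A_e ∈ Q_e`.  Test a connected `B` of `Q_e`
against the object `B̃` of `∏ Q_f` equal to `B` at `e` and initial elsewhere — connected by
`isConnectedObj_of_apply'`; a connected `C̃ → B̃`, `C̃ → A` has its unique non-initial coordinate at `e`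
(strictness of initial objects), and `C̃_e → B`, `C̃_e → A_e`. [cite: MochizukiSemiAnbd2006, Prop A.2(i) p.80] -/
theorem isNondegenerateObj_eval {E : Type} (Q : E → Type u₁) [∀ e, Category.{v₁} (Q e)]
    (hQ : ∀ e, IsConnectedQuasiTemperoid.{v₁, u₁, u} (Q e)) {A : ∀ f, Q f}
    (hA : IsNondegenerateObj A) (e : E) : IsNondegenerateObj (A e) := by
  classical
  haveI : ∀ f, HasInitial (Q f) := fun f => hasInitial_of_isConnectedQuasiTemperoid (hQ f)
  have hstrict : ∀ f {X Y : Q f} (_ : X ⟶ Y), IsNonemptyObj X → IsNonemptyObj Y :=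
    fun f {_ _} k hX => isNonemptyObj_of_hom' (hQ f) k hX
  have hbot : ∀ f, ¬ IsNonemptyObj (⊥_ (Q f)) := fun f h => h.false initialIsInitial
  intro B hB
  let B' : ∀ f, Q f := Function.update (fun f => ⊥_ (Q f)) e B
  have hB'e : B' e = B := Function.update_self e B _
  have hB'f : ∀ f, f ≠ e → B' f = ⊥_ (Q f) := fun f hf => Function.update_of_ne hf B _
  have hB' : IsConnectedObj B' :=
    TemperoidProduct.isConnectedObj_of_apply' hstrict e (by rw [hB'e]; exact hB)
      (fun j hj => by rw [hB'f j hj]; exact hbot j)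
  obtain ⟨C, hC, ⟨k⟩, ⟨l⟩⟩ := hA B' hB'
  obtain ⟨i₀, hCi₀, -⟩ := TemperoidProduct.isConnectedObj_apply hC
  have hi : i₀ = e := by
    by_contra hi
    have h := hstrict i₀ (k i₀) hCi₀.1
    rw [hB'f i₀ hi] at h
    exact hbot i₀ h
  rw [hi] at hCi₀
  exact ⟨C e, hCi₀, ⟨k e ≫ eqToHom hB'e⟩, ⟨l e⟩⟩

/-- **Proposition A.2 (i), DISCHARGED** (SemiAnbd Appendix p. 80): for a countable family of connected
quasi-temperoids `Q_e` and `Q = ∏_e Q_e`, "the natural projection functor `π_e^* : Q → Q_e` determines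
a morphism of quasi-temperoids `Q_e → Q`" — `Pi.eval Q e` preserves finite limits and countable
colimits (indeed all limits and colimits) and nondegenerate objects ("follows immediately from the
definitions", p. 81). [cite: MochizukiSemiAnbd2006, Prop A.2(i) p.80] -/
theorem PropA2i_holds : PropA2i.{v₁, u, u₁} := by
  intro E _ Q _ hQ e
  exact ⟨⟨Pi.eval Q e, TemperoidProduct.preservesFiniteLimits_eval e,
      fun J _ _ => TemperoidProduct.preservesColimitsOfShape_eval e⟩,
    rfl, fun A hA => isNondegenerateObj_eval Q hQ hA e⟩

end Literature.AnabelianGeometry.SemiGraphs
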